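import Mathlib
import Summits.KontsevichZagierPeriods.KontsevichZagierPeriods.Theorems.FermatIsogenyBetaProductSectorDefs
import Summits.KontsevichZagierPeriods.KontsevichZagierPeriods.Theorems.FermatIsogenyBetaProductSectorUniformInstances
import Literature.NumberTheory.Transcendental.GammaMonomialsProofs

/-!
# `BetaProductSector` (stmt-KontsevichZagierPeriods-3898), line `registered` v3 — DD and X9 are `UniformStep`s

Value identities (two Legendre duplications each, one `linear_combination`) and the `UniformStep` packaging of the two
reflection-free duplication schemas that, with QUAD, DIR and Hodge-LIN, connect ALL weight-0 Hodge classes of (2,2) Beta words at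
level 22 (lead c3, `Cruxes/BetaProductSector/REVIVAL.md` §9):
* DD: `B(c+½−d, 2c+2d)·B(c,d) = 4^d·B(2c, c+d+½)·B(c+½−d, d)` (`0 < c, d`, `d < c+½`),
* X9: `B(a+b−½, b+½)·B(b, a+½−b) = 4^{a−b}·B(a+b−½, a+½−b)·B(a, 2b)` (`0 < b`, `½ < a+b`, `b < a+½`).
-/

noncomputable section
open Real

namespace Summit.KontsevichZagierPeriods.FermatIsogeny.BetaProductSectorStubs

/-- `4^d · 2^{1−2(c+d)} = 2^{1−2c}`. [folklore] -/
theorem four_rpow_dd (c d : ℝ) : (4:ℝ) ^ d * (2:ℝ) ^ (1 - 2 * (c + d)) = (2:ℝ) ^ (1 - 2 * c) := by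
  rw [show (4:ℝ) = (2:ℝ) ^ (2:ℝ) by norm_num, ← Real.rpow_mul (by norm_num : (0:ℝ) ≤ 2), ← Real.rpow_add two_pos]
  congr 1; ring

/-- **Value identity of DD**: `B(c+½−d, 2c+2d)·B(c,d) = 4^d·B(2c, c+d+½)·B(c+½−d, d)` (`c, d > 0`; as an
identity of `Real.Gamma` quotients no upper bound on `d` is needed). [cite: AndrewsAskeyRoy1999, Thm 1.5.1] -/
theorem beta_dd_identity (c d : ℝ) (hc : 0 < c) (hd : 0 < d) :
    ProbabilityTheory.beta (c + 1 / 2 - d) (2 * c + 2 * d) * ProbabilityTheory.beta c d =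
      (4:ℝ) ^ d * (ProbabilityTheory.beta (2 * c) (c + d + 1 / 2) * ProbabilityTheory.beta (c + 1 / 2 - d) d) := by
  simp only [ProbabilityTheory.beta]
  rw [show c + 1 / 2 - d + (2 * c + 2 * d) = 3 * c + d + 1 / 2 by ring, show 2 * c + (c + d + 1 / 2) = 3 * c + d + 1 / 2 by ring,
    show 2 * c + 2 * d = 2 * (c + d) by ring, show c + d + 1 / 2 = (c + d) + 1 / 2 by ring,
    show c + 1 / 2 - d + d = c + 1 / 2 by ring]
  have Dc := Real.Gamma_mul_Gamma_add_half c
  have Dcd := Real.Gamma_mul_Gamma_add_half (c + d)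
  have E := four_rpow_dd c d
  have hg : ∀ t : ℝ, 0 < t → Real.Gamma t ≠ 0 := fun t ht => (Real.Gamma_pos_of_pos ht).ne'
  have h1 := hg (3 * c + d + 1 / 2) (by linarith)
  have h2 := hg (c + d) (by linarith)
  have h3 := hg (c + 1 / 2) (by linarith)
  rw [div_mul_div_comm, div_mul_div_comm, ← mul_div_assoc, div_eq_div_iff (mul_ne_zero h1 h2) (mul_ne_zero h1 h3)]
  linear_combination
    (Real.Gamma (c + 1 / 2 - d) * Real.Gamma (2 * (c + d)) * Real.Gamma d * Real.Gamma (3 * c + d + 1 / 2)) * Dc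
    - ((4:ℝ) ^ d * Real.Gamma (2 * c) * Real.Gamma (c + 1 / 2 - d) * Real.Gamma d * Real.Gamma (3 * c + d + 1 / 2)) * Dcd
    - (Real.Gamma (c + 1 / 2 - d) * Real.Gamma d * Real.Gamma (3 * c + d + 1 / 2) * Real.Gamma (2 * (c + d)) *
        Real.Gamma (2 * c) * √π) * E

/-- `4^{a−b} · 2^{1−2a} = 2^{1−2b}`. [folklore] -/
theorem four_rpow_twin (a b : ℝ) : (4:ℝ) ^ (a - b) * (2:ℝ) ^ (1 - 2 * a) = (2:ℝ) ^ (1 - 2 * b) := by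
  rw [show (4:ℝ) = (2:ℝ) ^ (2:ℝ) by norm_num, ← Real.rpow_mul (by norm_num : (0:ℝ) ≤ 2), ← Real.rpow_add two_pos]
  congr 1; ring

/-- **Value identity of X9**: `B(a+b−½, b+½)·B(b, a+½−b) = 4^{a−b}·B(a+b−½, a+½−b)·B(a, 2b)`. [cite: AndrewsAskeyRoy1999, Thm 1.5.1] -/
theorem beta_twinDup_identity (a b : ℝ) (hb : 0 < b) (hab : 1 / 2 < a + b) (hba : b < a + 1 / 2) :
    ProbabilityTheory.beta (a + b - 1 / 2) (b + 1 / 2) * ProbabilityTheory.beta b (a + 1 / 2 - b) =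
      (4:ℝ) ^ (a - b) * (ProbabilityTheory.beta (a + b - 1 / 2) (a + 1 / 2 - b) * ProbabilityTheory.beta a (2 * b)) := by
  simp only [ProbabilityTheory.beta]
  rw [show a + b - 1 / 2 + (b + 1 / 2) = a + 2 * b by ring, show b + (a + 1 / 2 - b) = a + 1 / 2 by ring,
    show a + b - 1 / 2 + (a + 1 / 2 - b) = 2 * a by ring]
  have Da := Real.Gamma_mul_Gamma_add_half a
  have Db := Real.Gamma_mul_Gamma_add_half b
  have E := four_rpow_twin a b
  have hg : ∀ t : ℝ, 0 < t → Real.Gamma t ≠ 0 := fun t ht => (Real.Gamma_pos_of_pos ht).ne'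
  have ha : 0 < a := by linarith
  have h1 := hg (a + 2 * b) (by linarith)
  have h2 := hg (a + 1 / 2) (by linarith)
  have h3 := hg (2 * a) (by linarith)
  rw [div_mul_div_comm, div_mul_div_comm, ← mul_div_assoc, div_eq_div_iff (mul_ne_zero h1 h2) (mul_ne_zero h3 h1)]
  linear_combination
    (Real.Gamma (a + b - 1 / 2) * Real.Gamma (a + 1 / 2 - b) * Real.Gamma (2 * a) * Real.Gamma (a + 2 * b)) * Db
    - ((4:ℝ) ^ (a - b) * Real.Gamma (a + b - 1 / 2) * Real.Gamma (a + 1 / 2 - b) * Real.Gamma (2 * b) *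
        Real.Gamma (a + 2 * b)) * Da
    - (Real.Gamma (a + b - 1 / 2) * Real.Gamma (a + 1 / 2 - b) * Real.Gamma (a + 2 * b) * Real.Gamma (2 * a) *
        Real.Gamma (2 * b) * √π) * E

/-- `4^q` is algebraic for rational `q`. [folklore] -/
theorem isAlgebraic_four_rpow_rat (q : ℚ) : IsAlgebraic ℚ ((4:ℝ) ^ (q:ℝ)) := by
  have h := Literature.NumberTheory.Transcendental.KoblitzOgus.isAlgebraic_nat_rpow_rat (m := 4) (by norm_num) q.num (q := q.den) q.pos
  have hq : (q:ℝ) = (q.num : ℝ) / (q.den : ℝ) := by exact_mod_cast (Rat.num_div_den q).symm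
  rw [hq]
  exact_mod_cast h

/-- **DD is a uniform step** of the chain normal form (`0 < c, d`, `d < c+½`), constant `4^d`. [cite: AndrewsAskeyRoy1999, Thm 1.5.1] -/
theorem dd_uniformStep : ∀ (c d : ℚ), 0 < c → 0 < d → d < c + 1 / 2 →
    Summit.KontsevichZagierPeriods.FermatIsogeny.BetaProductSectorDefs.UniformStep ((c + 1 / 2 - d, 2 * c + 2 * d), (c, d))
      ((2 * c, c + d + 1 / 2), (c + 1 / 2 - d, d)) := by
  intro c d hc hd hcd
  refine ⟨c + 1 / 2 - d, 2 * c + 2 * d, c, d, 2 * c, c + d + 1 / 2, c + 1 / 2 - d, d, 1, 2, 1, 0, 2, 1, 1, 0,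
    (4:ℝ) ^ (d:ℝ), by linarith, by linarith, hc, hd, by linarith, by linarith, by linarith, hd, dd_isFullyUniform c d,
    isAlgebraic_four_rpow_rat d, ?_, rfl, rfl⟩
  have h := beta_dd_identity (c : ℝ) (d : ℝ) (by exact_mod_cast hc) (by exact_mod_cast hd)
  push_cast
  exact h

/-- **X9 (twin duplication) is a uniform step** of the chain normal form (`0 < b`, `½ < a+b`, `b < a+½`), constant `4^{a−b}`.
[cite: AndrewsAskeyRoy1999, Thm 1.5.1] -/
theorem twinDup_uniformStep : ∀ (a b : ℚ), 0 < b → 1 / 2 < a + b → b < a + 1 / 2 →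
    Summit.KontsevichZagierPeriods.FermatIsogeny.BetaProductSectorDefs.UniformStep ((a + b - 1 / 2, b + 1 / 2), (b, a + 1 / 2 - b))
      ((a + b - 1 / 2, a + 1 / 2 - b), (a, 2 * b)) := by
  intro a b hb hab hba
  have ha : 0 < a := by linarith
  refine ⟨a + b - 1 / 2, b + 1 / 2, b, a + 1 / 2 - b, a + b - 1 / 2, a + 1 / 2 - b, a, 2 * b, 2, 1, 1, 0, 2, 0, 1, 2,
    (4:ℝ) ^ (((a - b : ℚ)) : ℝ), by linarith, by linarith, hb, by linarith, by linarith, by linarith, ha, by linarith,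
    twinDup_isFullyUniform a b, isAlgebraic_four_rpow_rat (a - b), ?_, rfl, rfl⟩
  have hab' : (1:ℝ) / 2 < (a:ℝ) + (b:ℝ) := by
    have h0 := (Rat.cast_lt (K := ℝ)).mpr hab
    push_cast at h0
    linarith
  have hba' : (b:ℝ) < (a:ℝ) + 1 / 2 := by
    have h0 := (Rat.cast_lt (K := ℝ)).mpr hba
    push_cast at h0
    linarith
  have h := beta_twinDup_identity (a : ℝ) (b : ℝ) (by exact_mod_cast hb) hab' hba'
  push_cast
  exact h

end Summit.KontsevichZagierPeriods.FermatIsogeny.BetaProductSectorStubs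

end
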